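import Literature.NumberTheory.EllipticCurves.InertiaFixedTorsionOfTamagawaProofs
import Literature.NumberTheory.EllipticCurves.SelmerInertiaProofs
import Literature.NumberTheory.EllipticCurves.InertiaInvariantsAdditiveProofs
import Literature.NumberTheory.Automorphic.CDTTheorem722SerreLevelProofs
import HarnessLib

/-!
# The Artin exponent of `E[3]` at an additive place `v ∤ 3` with `3 ∣ c_v` is `a_v(V_3 E) - 1`
# (`E[3]^{I_𝔓}` is EXACTLY a line for the global inertia group; tame `v ∤ 6`: `a_v(E[3]) = 1`)

`Proofs` file (theorems only, no definitions, no named facts), topic `NumberTheory/EllipticCurves`;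
the `p = 3` companion of the `p ≥ 5` statements `E[p]^{I_𝔓} = 0`, `a_v(E[p] ⊗ k) = a_v(V_p E)` at an
additive `v ∤ p` (Kraus 1997, p. 1143: at the additive primes Serre's level has the full conductor
exponent when `p ≥ 5`).  At `p = 3` the one exception is a tame potentially good place of Kodaira
type `IV`/`IV*` (`e_v = 3`, `3 ∣ #Φ_v(k̄)`), where `E[3]^{I_v} = E(K_v^nr)[3] ≅ Φ_v(k̄_v)[3]` is a LINE
and the inertia acts on `E[3]` through a unipotent group of order `3` (Serre 1987 §1.2; Kraus 1997;
the "shadow primes" of line `shadow_seed` of crux `KobayashiLowerHalfLargeImage`, item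
stmt-BirchSwinnertonDyer-19001).  This file treats the sub-case `3 ∣ c_v` (the line is even
`K_v`-rational; for `K = ℚ` this is every census shadow prime), building on the local-inertia line of
`InertiaFixedTorsionOfTamagawaProofs`:

* §0 `resGalOfEmb_closureEmb_comp_inv_apply` — the restriction `Γ_{K_v} → Γ_K` along the conjugate
  embedding `closureEmb ∘ g⁻¹` is `σ ↦ g · res σ · g⁻¹` (bookkeeping on `resGalOfEmb_comp`).
* §1 `natCard_fixedSubmodule_inertia_torsionGaloisRep_three_eq` — **`#E[3]^{I_𝔓} = 3` for the GLOBAL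
  inertia group `I_𝔓 ≤ Γ_K` at EVERY prime `𝔓 ∣ v` of `\bar ℤ_K`**: the local line `L`
  (`exists_line_geomTorsion_three_absInertia_fixed_of_dvd_localTamagawaNumber`: `#L = 3`, fixed by
  `absInertia K_v`, containing every `absInertia`-fixed `3`-torsion point) is carried to `E[3]^{I_𝔓}`
  by `P ↦ g • P` when `𝔓 = 𝔓_{closureEmb ∘ g⁻¹, 𝔐}` (`Γ_K` is transitive on the primes above `v`,
  `exists_smul_eq_of_mem_primesAbove_holds`, `primeBelow_comp`): local inertia SURJECTS onto `I_𝔓`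
  (`exists_mem_inertia_apply_eq_holds`, Neukirch II (9.6)) so `g • L ⊆ E[3]^{I_𝔓}`, and lands in it
  (`resGalOfEmb_mem_inertia_primeBelow`) so `g⁻¹ • E[3]^{I_𝔓} ⊆ L` by maximality of `L`.  Hence
  `dim E[3]^{I_𝔓} = 1` (`finrank_…_eq_one`) and **`codim E[3]^{I_𝔓} = 1`**
  (`codimFixed_inertia_torsionGaloisRep_three_eq_one`).
* §2 `artinConductorExponent_baseChange_three_add_one_eq_of_dvd_localTamagawaNumber` —
  **`a_v(E[3] ⊗ k) + 1 = a_v(V_3 E)`** for any framed model `ρ̄` of `E[3]` and `j : 𝔽₃ → k`: the tame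
  parts are `1` (§1, after `codimFixed_toContinuousRep_baseChange` and
  `IsTorsionGaloisRep.codimFixed_toGaloisRep_eq`) and `2` (*ATAEC* IV.10.2(a),
  `codimFixed_inertia_rationalTate_eq_two_of_hasAdditiveReductionAt_holds`), the Swan parts agree
  (`swanConductorAt_rationalTate_eq_swanConductorAt_torsion`).
* §3 `artinConductorExponent_baseChange_three_eq_one_of_dvd_localTamagawaNumber_of_ringChar_ne` —
  **at `v ∤ 6`: `a_v(E[3] ⊗ k) = 1` unconditionally** (Swan `= 0`, *ATAEC* IV.10.2(b) clause `p ≥ 5`,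
  `swanConductorAt_rationalTate_eq_zero_of_ringChar_ne_holds`); and, granted Ogg–Saito for `(E, 3)` BY
  NAME (`artinConductorExponent_tate_eq_conductorExponent_of_isElliptic W 3`, needed only at `v ∣ 2`),
  `a_v(E[3] ⊗ k) + 1 = f_v(E)` (`…_add_one_eq_conductorExponent_…`).

So at a shadow prime `q` of `E/ℚ` with `c_q = 3` the prime-to-`3` Artin conductor of `ρ̄_{E,3}` has
`q`-exponent `f_q(E) - 1 = 1` (`q ∥ N(ρ̄)`): the level input of the Ribet–Diamond step of
`ShadowSeedTransport` (the `ℚ`-corollary on `serreLevel` is drawn in the Summits consumer).  HONEST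
FRAMING: theorems about elliptic curves over number fields; no `sorry`, no new definition, no named-fact
hypothesis except Ogg–Saito where displayed; nothing here proves any crux or summit statement.

References: J.-P. Serre, Duke Math. J. 54 (1987), §1.2, §4.6 [Serre1987]; A. Kraus, Canad. J. Math. 49
(1997), p. 1143 [Kraus1997]; J. H. Silverman, *AEC* (2009) VII.6.1 and proof of VII.7.1; *ATAEC* (1994)
IV.9.2(d), Table 4.1, IV.10.2 [SilvermanAEC2009, SilvermanATAEC1994]; J. Neukirch, *ANT* (1999) II (9.6)
[NeukirchANT1999]; J.-P. Serre, *Local Fields* VI §2 [SerreLocalFields1979].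

Design: no definitions; `noncomputable section`; universe `u`; the `ℤ/3`-module structure on `E[3]` is
Mathlib's `AddSubgroup.torsionBy.zmodModule`, supplied inline by `letI` (as in the `p ≥ 5` companion),
never as an instance.
-/

noncomputable section

open scoped Classical NNReal Pointwise NumberField
open NumberField IsDedekindDomain Field Module

universe u

/-! ### §0 Restriction along a conjugated embedding -/

namespace Literature.NumberTheory.EllipticCurves

open Literature.NumberTheory.GaloisRepresentations IsDedekindDomain.HeightOneSpectrum

/-- **Restriction along a conjugate of the chosen embedding.** For a number field `K`, a finite place
`v` and `g ∈ Γ_K`: the restriction `Γ_{K_v} → Γ_K` along the embedding `closureEmb ∘ g⁻¹ : K̄ → K̄_v`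
is `σ ↦ g · res(σ) · g⁻¹`, the conjugate of the restriction `res = absGaloisRestrict K K_v` along the
chosen embedding (`resGalOfEmb_comp`: `res_{ι ∘ τ} = τ⁻¹ · res_ι · τ`, with `τ = g⁻¹`); two
compatible restriction maps differ by an inner automorphism.
[cite: SerreGaloisCohomology1997, I §2.4 (compatible pairs) and II §1.1] -/
theorem resGalOfEmb_closureEmb_comp_inv_apply {K : Type u} [Field K] [NumberField K]
    (v : HeightOneSpectrum (𝓞 K)) (g : absoluteGaloisGroup K)
    (σ : absoluteGaloisGroup (v.adicCompletion K)) :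
    resGalOfEmb ((closureEmb (K := K) (v.adicCompletion K)).comp
        ((show AlgebraicClosure K ≃ₐ[K] AlgebraicClosure K from g⁻¹) :
          AlgebraicClosure K →ₐ[K] AlgebraicClosure K)) σ =
      g * absGaloisRestrict K (v.adicCompletion K) σ * g⁻¹ := by
  have h := resGalOfEmb_comp (closureEmb (K := K) (v.adicCompletion K))
    (show AlgebraicClosure K ≃ₐ[K] AlgebraicClosure K from g⁻¹)
  rw [DFunLike.congr_fun h σ]
  show (g⁻¹)⁻¹ * resGalOfEmb (closureEmb (K := K) (v.adicCompletion K)) σ * g⁻¹ = _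
  rw [inv_inv]
  rfl

end Literature.NumberTheory.EllipticCurves

namespace WeierstrassCurve

open Literature.NumberTheory.EllipticCurves Literature.NumberTheory.GaloisRepresentations
  IsDedekindDomain.HeightOneSpectrum

variable {K : Type u} [Field K] [NumberField K] (W : WeierstrassCurve K) {v : HeightOneSpectrum (𝓞 K)}

/-! ### §1 The inertia-fixed part of `E[3]` for the GLOBAL inertia group `I_𝔓 ≤ Γ_K` -/

/-- **`#E[3]^{I_𝔓} = 3` at an additive `v ∤ 3` with `3 ∣ c_v`, at every prime `𝔓 ∣ v` of `\bar ℤ_K`.**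
For `E/K` elliptic over a number field, a finite place `v ∤ 3` of ADDITIVE reduction whose local
Tamagawa number `c_v = [E(K_v) : E₀(K_v)]` is divisible by `3` (Kodaira type `IV` or `IV*` with
`c_v = 3`), and a prime `𝔓` of `\bar ℤ_K` above `v`: the subspace of the `3`-torsion `E[3] ⊆ E(K̄)` fixed
by the inertia group `I_𝔓 = 𝔓.inertia Γ_K` (`ContinuousRep.fixedSubmodule` of `torsionGaloisRep`)
has exactly `3` points.  Proof: write `𝔓 = 𝔓_{ι,𝔐}` for the embedding `ι = closureEmb ∘ g⁻¹`
(`exists_smul_eq_of_mem_primesAbove_holds`, `primeBelow_comp`), along which `res_ι σ = g·res σ·g⁻¹`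
(`resGalOfEmb_closureEmb_comp_inv_apply`); the local line `L` of
`exists_line_geomTorsion_three_absInertia_fixed_of_dvd_localTamagawaNumber` (`#L = 3`, `absInertia K_v`
-fixed, maximal) satisfies `g • L = E[3]^{I_𝔓}`: `⊆` because every `τ ∈ I_𝔓` is `res_ι σ` for some
`σ` in the local inertia group `I_𝔐 = absInertia K_v` (`exists_mem_inertia_apply_eq_holds`,
`inertia_eq_absInertia`; Neukirch II (9.6)), `⊇` because `res_ι(I_𝔐) ⊆ I_𝔓`
(`resGalOfEmb_mem_inertia_primeBelow`) and `L` contains every `absInertia`-fixed `3`-torsion point.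
[cite: SilvermanAEC2009, Thm. VII.6.1 (PDF p. 177) and proof of Thm. VII.7.1 (PDF p. 179)]
[cite: SilvermanATAEC1994, Cor. IV.9.2(d) with Table 4.1 (PDF pp. 340, 365)]
[cite: NeukirchANT1999, Ch. II §9 Prop. (9.6)] -/
theorem natCard_fixedSubmodule_inertia_torsionGaloisRep_three_eq [W.IsElliptic]
    (hadd : W.HasAdditiveReductionAt v) (h3v : (3 : 𝓞 K) ∉ v.asIdeal)
    (hdvd : 3 ∣ (W.baseChange (v.adicCompletion K)).localTamagawaNumber (v.adicCompletionIntegers K))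
    {𝔓 : Ideal (absIntegers (𝓞 K) K)} (h𝔓 : 𝔓 ∈ v.primesAbove) :
    letI : Module (ZMod 3) (geomTorsion W (3 : ℕ)) := AddSubgroup.torsionBy.zmodModule
    Nat.card ((W.torsionGaloisRep 3).fixedSubmodule (𝔓.inertia (absoluteGaloisGroup K))) = 3 := by
  letI : Module (ZMod 3) (geomTorsion W (3 : ℕ)) := AddSubgroup.torsionBy.zmodModule
  obtain ⟨w, hw⟩ := v.exists_spectralValuation
  obtain ⟨𝔐, h𝔐⟩ := v.localPrimesAbove_nonempty
  -- `𝔓` is cut out by a conjugate `ι = closureEmb ∘ g⁻¹` of the chosen embedding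
  obtain ⟨g, hg⟩ := HeightOneSpectrum.exists_smul_eq_of_mem_primesAbove_holds
    (HeightOneSpectrum.primeBelow_mem_primesAbove
      (ι := closureEmb (K := K) (v.adicCompletion K)) h𝔐) h𝔓
  set ι : AlgebraicClosure K →ₐ[K] AlgebraicClosure (v.adicCompletion K) :=
    (closureEmb (K := K) (v.adicCompletion K)).comp
      ((show AlgebraicClosure K ≃ₐ[K] AlgebraicClosure K from g⁻¹) :
        AlgebraicClosure K →ₐ[K] AlgebraicClosure K) with hιdef
  have h1 : 𝔓 = v.primeBelow ι 𝔐 := by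
    rw [hιdef, HeightOneSpectrum.primeBelow_comp, ← hg]
    exact congrArg (· • _) (inv_inv g).symm
  have hres : ∀ σ : absoluteGaloisGroup (v.adicCompletion K),
      resGalOfEmb ι σ = g * absGaloisRestrict K (v.adicCompletion K) σ * g⁻¹ :=
    fun σ ↦ resGalOfEmb_closureEmb_comp_inv_apply v g σ
  -- the line of `E[3]` fixed by the LOCAL inertia group
  obtain ⟨L, hL3, hLcard, hLfix, hLmax⟩ :=
    W.exists_line_geomTorsion_three_absInertia_fixed_of_dvd_localTamagawaNumber hadd h3v hdvd
  -- (a) `g • L` is fixed by `I_𝔓` (local inertia SURJECTS onto `I_𝔓`, Neukirch II (9.6))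
  have hfixP : ∀ P ∈ L, ∀ τ ∈ 𝔓.inertia (absoluteGaloisGroup K), τ • (g • P) = g • P := by
    intro P hP τ hτ
    rw [h1] at hτ
    obtain ⟨σ, hσ, hστ⟩ := v.exists_mem_inertia_apply_eq_holds ι h𝔐 hτ
    have hτeq : resGalOfEmb ι σ = τ := resGalOfEmb_eq_of_apply_eq ι hστ
    rw [inertia_eq_absInertia hw h𝔐] at hσ
    rw [← hτeq, hres, mul_smul, mul_smul, inv_smul_smul, hLfix σ hσ P hP]
  -- (b) an `I_𝔓`-fixed `3`-torsion point `P` has `g⁻¹ • P ∈ L` (local inertia lands IN `I_𝔓`)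
  have hmemL : ∀ P : geomPoints W, P ∈ geomTorsion W ((3 : ℕ) : ℤ) →
      (∀ τ ∈ 𝔓.inertia (absoluteGaloisGroup K), τ • P = P) → g⁻¹ • P ∈ L := by
    intro P hP hfix
    have hP3 : (3 : ℤ) • P = 0 := by exact_mod_cast (mem_geomTorsion_iff W _ P).mp hP
    refine hLmax _ ((mem_geomTorsion_iff W (3 : ℤ) _).mpr ?_) ?_
    · rw [smul_comm, hP3, smul_zero]
    · intro σ hσ
      have hmem : resGalOfEmb ι σ ∈ 𝔓.inertia (absoluteGaloisGroup K) := by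
        rw [← inertia_eq_absInertia hw h𝔐] at hσ
        rw [h1]
        exact v.resGalOfEmb_mem_inertia_primeBelow ι 𝔐 hσ
      have h := hfix _ hmem
      rw [hres, mul_smul, mul_smul] at h
      have h' := congrArg (g⁻¹ • ·) h
      simpa only [inv_smul_smul] using h'
  -- the bijection `E[3]^{I_𝔓} ≃ L`, `P ↦ g⁻¹ • P`
  have hcard : Nat.card ((W.torsionGaloisRep 3).fixedSubmodule (𝔓.inertia (absoluteGaloisGroup K))) =
      Nat.card L := by
    refine Nat.card_congr
      { toFun := fun P ↦ ⟨g⁻¹ • ((P.1 : geomTorsion W ((3 : ℕ) : ℤ)) : geomPoints W),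
          hmemL _ P.1.2 ((W.mem_fixedSubmodule_torsionGaloisRep_iff 3 _ P.1).mp P.2)⟩
        invFun := fun Q ↦ ⟨⟨g • (Q : geomPoints W), ?_⟩, ?_⟩
        left_inv := fun P ↦ Subtype.ext (Subtype.ext (smul_inv_smul g _))
        right_inv := fun Q ↦ Subtype.ext (inv_smul_smul g _) }
    · have hQ3 : ((3 : ℕ) : ℤ) • (Q : geomPoints W) = 0 := by
        exact_mod_cast (mem_geomTorsion_iff W (3 : ℤ) _).mp (hL3 Q.2)
      exact (mem_geomTorsion_iff W _ _).mpr (by rw [smul_comm, hQ3, smul_zero])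
    · exact (W.mem_fixedSubmodule_torsionGaloisRep_iff 3 _ _).mpr fun τ hτ ↦ hfixP _ Q.2 τ hτ
  rw [hcard, hLcard]

/-- **`dim_{𝔽₃} E[3]^{I_𝔓} = 1`** at an additive `v ∤ 3` with `3 ∣ c_v`, `𝔓 ∣ v`: the inertia-fixed part
of the `3`-torsion is exactly a LINE (`#E[3]^{I_𝔓} = 3 = 3 ^ dim`,
`natCard_fixedSubmodule_inertia_torsionGaloisRep_three_eq`). [cite: SilvermanATAEC1994, Cor. IV.9.2(d) with Table 4.1 (PDF pp. 340, 365)]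
[cite: Serre1987, §1.2] -/
theorem finrank_fixedSubmodule_inertia_torsionGaloisRep_three_eq_one [W.IsElliptic]
    (hadd : W.HasAdditiveReductionAt v) (h3v : (3 : 𝓞 K) ∉ v.asIdeal)
    (hdvd : 3 ∣ (W.baseChange (v.adicCompletion K)).localTamagawaNumber (v.adicCompletionIntegers K))
    {𝔓 : Ideal (absIntegers (𝓞 K) K)} (h𝔓 : 𝔓 ∈ v.primesAbove) :
    letI : Module (ZMod 3) (geomTorsion W (3 : ℕ)) := AddSubgroup.torsionBy.zmodModule
    finrank (ZMod 3) ((W.torsionGaloisRep 3).fixedSubmodule (𝔓.inertia (absoluteGaloisGroup K))) = 1 := by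
  letI : Module (ZMod 3) (geomTorsion W (3 : ℕ)) := AddSubgroup.torsionBy.zmodModule
  haveI : Finite (geomTorsion W (3 : ℕ)) := W.finite_geomTorsion_nat (by norm_num)
  have h := Module.natCard_eq_pow_finrank (K := ZMod 3)
    (V := (W.torsionGaloisRep 3).fixedSubmodule (𝔓.inertia (absoluteGaloisGroup K)))
  rw [W.natCard_fixedSubmodule_inertia_torsionGaloisRep_three_eq hadd h3v hdvd h𝔓, Nat.card_zmod] at h
  have h' : 3 ^ 1 = 3 ^ finrank (ZMod 3)
      ((W.torsionGaloisRep 3).fixedSubmodule (𝔓.inertia (absoluteGaloisGroup K))) := by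
    rw [pow_one]; exact h
  exact (Nat.pow_right_injective (by norm_num : 2 ≤ 3) h').symm

/-- **`codim E[3]^{I_𝔓} = 1`** at an additive `v ∤ 3` with `3 ∣ c_v`, `𝔓 ∣ v`: the tame part of the Artin
exponent of the `3`-torsion at such a place is `1` (not `2` as for `V_3 E`, *ATAEC* IV.10.2(a), or for
`E[p]`, `p ≥ 5`): `2 - dim E[3]^{I_𝔓}` (`finrank_geomTorsion_eq_two`,
`finrank_fixedSubmodule_inertia_torsionGaloisRep_three_eq_one`).
[cite: SilvermanATAEC1994, Thm. IV.10.2(a) (PDF p. 358) and Cor. IV.9.2(d)] [cite: Serre1987, §1.2] -/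
theorem codimFixed_inertia_torsionGaloisRep_three_eq_one [W.IsElliptic]
    (hadd : W.HasAdditiveReductionAt v) (h3v : (3 : 𝓞 K) ∉ v.asIdeal)
    (hdvd : 3 ∣ (W.baseChange (v.adicCompletion K)).localTamagawaNumber (v.adicCompletionIntegers K))
    {𝔓 : Ideal (absIntegers (𝓞 K) K)} (h𝔓 : 𝔓 ∈ v.primesAbove) :
    letI : Module (ZMod 3) (geomTorsion W (3 : ℕ)) := AddSubgroup.torsionBy.zmodModule
    (W.torsionGaloisRep 3).codimFixed (𝔓.inertia (absoluteGaloisGroup K)) = 1 := by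
  letI : Module (ZMod 3) (geomTorsion W (3 : ℕ)) := AddSubgroup.torsionBy.zmodModule
  have hp0 : ((3 : ℕ) : K) ≠ 0 := by norm_num
  haveI : Finite (geomTorsion W (3 : ℕ)) := W.finite_geomTorsion_nat (by norm_num)
  haveI : Module.Finite (ZMod 3) (geomTorsion W (3 : ℕ)) := Module.Finite.of_finite
  rw [ContinuousRep.codimFixed_eq_finrank_sub, W.finrank_geomTorsion_eq_two 3 hp0,
    W.finrank_fixedSubmodule_inertia_torsionGaloisRep_three_eq_one hadd h3v hdvd h𝔓]

/-! ### §2 The Artin exponent: `a_v(E[3] ⊗ k) + 1 = a_v(V_3 E)` -/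

section Exponent

open MeasureTheory Literature.NumberTheory.Automorphic.BCDT

/-- **`a_v(ρ̄_{E,3} ⊗ k) + 1 = a_v(V_3 E)` at an ADDITIVE place `v ∤ 3` with `3 ∣ c_v`.**  For `E/K`
elliptic over a number field, a framed model `ρ̄` of `E[3]` (`IsTorsionGaloisRep`), `j : 𝔽₃ → k`, and a
place `v ∤ 3` of additive reduction with `3 ∣ c_v`: the Artin exponent `⌊codim M^{I_𝔓} + Sw_𝔓(M)⌋₊` at
the chosen `𝔓 ∣ v` is one less for `M = E[3] ⊗ k` than for `M = V_3 E`
(`Literature.NumberTheory.EllipticCurves.conductorExponentOf`): the inertia terms are `1`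
(`codimFixed_inertia_torsionGaloisRep_three_eq_one`, after `codimFixed_toContinuousRep_baseChange` and
`IsTorsionGaloisRep.codimFixed_toGaloisRep_eq`) and `2`
(`codimFixed_inertia_rationalTate_eq_two_of_hasAdditiveReductionAt_holds`, *ATAEC* IV.10.2(a)), the
Swan terms agree (`swanConductorAt_rationalTate_eq_swanConductorAt_torsion`) and are `≥ 0`.  (Contrast
`p ≥ 5`, where the two exponents are equal: Kraus 1997, p. 1143.)
[cite: Serre1987, §1.2 and §4.6 (4.6.3)] [cite: Kraus1997, p. 1143]
[cite: SilvermanATAEC1994, Thm. IV.10.2(a) (PDF p. 358)] -/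
theorem artinConductorExponent_baseChange_three_add_one_eq_of_dvd_localTamagawaNumber
    {K : Type u} [Field K] [NumberField K] {W : WeierstrassCurve K} [W.IsElliptic]
    {ρ : FramedGaloisRep K (ZMod 3) 2} (hρ : W.IsTorsionGaloisRep 3 ρ)
    {k : Type*} [Field k] [TopologicalSpace k] [IsTopologicalRing k]
    (j : ZMod 3 →+* k) (hj : Continuous j)
    (h : Continuous fun x : absoluteGaloisGroup K × RationalTateModule (geomPoints W) 3 ↦
      rationalTateRepresentation (absoluteGaloisGroup K) (geomPoints W) 3 x.1 x.2)
    {v : HeightOneSpectrum (𝓞 K)} (hv : (3 : 𝓞 K) ∉ v.asIdeal) (hadd : W.HasAdditiveReductionAt v)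
    (hdvd : 3 ∣ (W.baseChange (v.adicCompletion K)).localTamagawaNumber (v.adicCompletionIntegers K)) :
    (FramedGaloisRep.toGaloisRep (ρ.baseChange j hj)).artinConductorExponent v + 1 =
      conductorExponentOf (geomPoints W) 3 h v := by
  letI : Module (ZMod 3) (geomTorsion W (3 : ℕ)) := AddSubgroup.torsionBy.zmodModule
  have hp0 : ((3 : ℕ) : K) ≠ 0 := by norm_num
  have hv' : ((3 : ℕ) : 𝓞 K) ∉ v.asIdeal := by exact_mod_cast hv
  set 𝔓 := (HeightOneSpectrum.primesAbove_nonempty v).some with h𝔓def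
  have h𝔓 : 𝔓 ∈ v.primesAbove := (HeightOneSpectrum.primesAbove_nonempty v).some_mem
  have hcodim : ∀ H : Subgroup (absoluteGaloisGroup K),
      (FramedGaloisRep.toGaloisRep (ρ.baseChange j hj)).codimFixed H =
        (W.torsionGaloisRep 3).codimFixed H :=
    fun H ↦ (codimFixed_toContinuousRep_baseChange ρ j hj H).trans (hρ.codimFixed_toGaloisRep_eq hp0 H)
  have hswan : (FramedGaloisRep.toGaloisRep (ρ.baseChange j hj)).swanConductorAt (𝓞 K) 𝔓 =
      (W.torsionGaloisRep 3).swanConductorAt (𝓞 K) 𝔓 := by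
    rw [GaloisRep.swanConductorAt_def, GaloisRep.swanConductorAt_def]
    congr 1
    funext u
    rw [hcodim]
  have hS0 : 0 ≤ (W.torsionGaloisRep 3).swanConductorAt (𝓞 K) 𝔓 :=
    GaloisRep.swanConductorAt_nonneg 𝔓 _
  unfold conductorExponentOf GaloisRep.artinConductorExponent
  rw [← h𝔓def, GaloisRep.artinConductorAt_def, GaloisRep.artinConductorAt_def, hcodim,
    W.codimFixed_inertia_torsionGaloisRep_three_eq_one hadd hv hdvd h𝔓,
    W.codimFixed_inertia_rationalTate_eq_two_of_hasAdditiveReductionAt_holds 3 h v hv' hadd h𝔓,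
    W.swanConductorAt_rationalTate_eq_swanConductorAt_torsion 3 h hv' h𝔓, hswan,
    add_comm ((1 : ℕ) : ℝ), add_comm ((2 : ℕ) : ℝ), Nat.floor_add_natCast hS0,
    Nat.floor_add_natCast hS0]

/-! ### §3 Consequences: `a_v(E[3] ⊗ k) = 1` at `v ∤ 6`; `a_v(E[3] ⊗ k) + 1 = f_v(E)` granted Ogg–Saito -/

/-- **`a_v(ρ̄_{E,3} ⊗ k) = 1` at an additive place `v ∤ 6` with `3 ∣ c_v` — unconditionally.**  At a place
of residue characteristic `≠ 2, 3` the `3`-torsion is TAMELY ramified (its Swan conductor is that of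
`V_3 E`, `swanConductorAt_rationalTate_eq_swanConductorAt_torsion`, which vanishes at `v ∤ 6·3`:
*ATAEC* IV.10.2(b), clause `p ≥ 5`, the tree's theorem
`swanConductorAt_rationalTate_eq_zero_of_ringChar_ne_holds`), so the Artin exponent is the tame part
`codim E[3]^{I_𝔓} = 1` (`codimFixed_inertia_torsionGaloisRep_three_eq_one`).  For `K = ℚ`: at a
shadow prime `q ≥ 5` (Kodaira `IV`/`IV*`, `c_q = 3`) one has `q ∥ N(ρ̄_{E,3})` although `q² ∥ N_E`.
[cite: SilvermanATAEC1994, Thm. IV.10.2(a)–(b) (PDF pp. 358–362)] [cite: Serre1987, §1.2]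
[cite: Kraus1997, p. 1143] -/
theorem artinConductorExponent_baseChange_three_eq_one_of_dvd_localTamagawaNumber_of_ringChar_ne
    {K : Type u} [Field K] [NumberField K] {W : WeierstrassCurve K} [W.IsElliptic]
    {ρ : FramedGaloisRep K (ZMod 3) 2} (hρ : W.IsTorsionGaloisRep 3 ρ)
    {k : Type*} [Field k] [TopologicalSpace k] [IsTopologicalRing k]
    (j : ZMod 3 →+* k) (hj : Continuous j)
    {v : HeightOneSpectrum (𝓞 K)} (hv : (3 : 𝓞 K) ∉ v.asIdeal)
    (h2 : ringChar (𝓞 K ⧸ v.asIdeal) ≠ 2) (hadd : W.HasAdditiveReductionAt v)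
    (hdvd : 3 ∣ (W.baseChange (v.adicCompletion K)).localTamagawaNumber (v.adicCompletionIntegers K)) :
    (FramedGaloisRep.toGaloisRep (ρ.baseChange j hj)).artinConductorExponent v = 1 := by
  letI : Module (ZMod 3) (geomTorsion W (3 : ℕ)) := AddSubgroup.torsionBy.zmodModule
  have hp0 : ((3 : ℕ) : K) ≠ 0 := by norm_num
  have hv' : ((3 : ℕ) : 𝓞 K) ∉ v.asIdeal := by exact_mod_cast hv
  -- `v ∤ 3` read on the residue characteristic
  have h3 : ringChar (𝓞 K ⧸ v.asIdeal) ≠ 3 := by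
    intro h3
    apply hv'
    have h0 : ((3 : ℕ) : 𝓞 K ⧸ v.asIdeal) = 0 := (ringChar.spec _ 3).mpr (h3 ▸ dvd_rfl)
    rwa [← map_natCast (Ideal.Quotient.mk v.asIdeal), Ideal.Quotient.eq_zero_iff_mem] at h0
  have h := W.continuous_rationalGaloisRepTate_holds 3
  set 𝔓 := (HeightOneSpectrum.primesAbove_nonempty v).some with h𝔓def
  have h𝔓 : 𝔓 ∈ v.primesAbove := (HeightOneSpectrum.primesAbove_nonempty v).some_mem
  have hcodim : ∀ H : Subgroup (absoluteGaloisGroup K),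
      (FramedGaloisRep.toGaloisRep (ρ.baseChange j hj)).codimFixed H =
        (W.torsionGaloisRep 3).codimFixed H :=
    fun H ↦ (codimFixed_toContinuousRep_baseChange ρ j hj H).trans (hρ.codimFixed_toGaloisRep_eq hp0 H)
  have hswan : (FramedGaloisRep.toGaloisRep (ρ.baseChange j hj)).swanConductorAt (𝓞 K) 𝔓 =
      (W.torsionGaloisRep 3).swanConductorAt (𝓞 K) 𝔓 := by
    rw [GaloisRep.swanConductorAt_def, GaloisRep.swanConductorAt_def]
    congr 1
    funext u
    rw [hcodim]
  unfold GaloisRep.artinConductorExponent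
  rw [← h𝔓def, GaloisRep.artinConductorAt_def, hcodim,
    W.codimFixed_inertia_torsionGaloisRep_three_eq_one hadd hv hdvd h𝔓, hswan,
    ← W.swanConductorAt_rationalTate_eq_swanConductorAt_torsion 3 h hv' h𝔓,
    W.swanConductorAt_rationalTate_eq_zero_of_ringChar_ne_holds 3 h v hv' h2 h3 h𝔓, add_zero,
    Nat.floor_natCast]

/-- **`a_v(ρ̄_{E,3} ⊗ k) + 1 = f_v(E)` at an additive `v ∤ 3` with `3 ∣ c_v`, granted Ogg–Saito for
`(E, 3)` BY NAME** (`artinConductorExponent_tate_eq_conductorExponent_of_isElliptic W 3`: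
`a_v(V_3 E) = f_v(E)`; its content beyond *ATAEC* IV.10.2 is Ogg's formula at the places `v ∣ 2`, the
only places where this corollary says more than `…_of_ringChar_ne`).  For `K = ℚ` at a shadow prime
`q = 2` (`v_2(Δ_min) ∈ {4, 8}` at type `IV`/`IV*`, so `f_2 = 2` by Ogg's formula) this reads
`2 ∥ N(ρ̄_{E,3})`. [cite: Serre1987, §1.2 and §4.6 (4.6.3)] [cite: Kraus1997, p. 1143]
[cite: SilvermanATAEC1994, IV.11.1 (Ogg's formula)] -/
theorem artinConductorExponent_baseChange_three_add_one_eq_conductorExponent_of_dvd_localTamagawaNumber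
    {K : Type u} [Field K] [NumberField K] {W : WeierstrassCurve K} [W.IsElliptic]
    (hOS : W.artinConductorExponent_tate_eq_conductorExponent_of_isElliptic 3)
    {ρ : FramedGaloisRep K (ZMod 3) 2} (hρ : W.IsTorsionGaloisRep 3 ρ)
    {k : Type*} [Field k] [TopologicalSpace k] [IsTopologicalRing k]
    (j : ZMod 3 →+* k) (hj : Continuous j)
    {v : HeightOneSpectrum (𝓞 K)} (hv : (3 : 𝓞 K) ∉ v.asIdeal) (hadd : W.HasAdditiveReductionAt v)
    (hdvd : 3 ∣ (W.baseChange (v.adicCompletion K)).localTamagawaNumber (v.adicCompletionIntegers K)) :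
    (FramedGaloisRep.toGaloisRep (ρ.baseChange j hj)).artinConductorExponent v + 1 =
      W.conductorExponent v := by
  have hv' : ((3 : ℕ) : 𝓞 K) ∉ v.asIdeal := by exact_mod_cast hv
  have h := W.continuous_rationalGaloisRepTate_holds 3
  rw [artinConductorExponent_baseChange_three_add_one_eq_of_dvd_localTamagawaNumber hρ j hj h hv hadd
    hdvd, hOS h v hv']

end Exponent

end WeierstrassCurve

end
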